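import Summits.NavierStokesRegularity.NavierStokesRegularity.Theorems.LocalSineTubeDoorProfileAlignedWindowRigidity
import Summits.NavierStokesRegularity.NavierStokesRegularity.Theorems.ScaledTopAlignmentTypeIProfileHessianTools
import Summits.NavierStokesRegularity.NavierStokesRegularity.Theorems.AdaptedFrequencyTangentFlowTransferFrequencyTools
import Summits.NavierStokesRegularity.NavierStokesRegularity.Theorems.ScaledTopAlignmentWindowBridge
import Summits.NavierStokesRegularity.NavierStokesRegularity.Theorems.ScaledTopAlignmentDirectionGradientLaLbTools
import Summits.NavierStokesRegularity.NavierStokesRegularity.Theorems.ClockStretchingLawClockCeilingStubTranslationInvariantAfter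
import Literature.Analysis.FluidPDE.VorticityCalculus
import Literature.Analysis.FluidPDE.Vorticity
import HarnessLib

/-!
# Route `ScaledTopAlignment`, crux W3ᵐᵗ = `AprioriMostTimesBulkAlignment` (stmt-NavierStokesRegularity-19551):
# Type-I blow-up PROFILES are UNIFORMLY BUDGET-decoherent — the rung Q(C) of the planner's SPLIT-9
# in its `L²`-direction-budget form

The cell planner's SPLIT-9 design (nsreg-p3 g4, ROUND-8 Addendum 3) splits the excluded Type-I scenario by the
DECOHERENCE RATIO of a near-maximal vorticity window: the scale-invariant `a = 3/2` direction budget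
`∫ |ω|^{3/2} ‖∇ξ‖²` against its saturation value `∫ |ω|^{5/2}` (`ξ = ω/|ω|`, unit viscosity). Its rung
Q(C) = `TypeIUniformDecoherence κ λ₀ R₀` reads: for every Type-I constant `C` there is ONE `δ > 0` such that NO
field of the zoom-limit class `IsTypeIAncientMild C` has a rate-floor window
`{λ₀|ω(y₀)| ≤ |ω|, |y − y₀| ≤ R₀/√|ω(y₀)|}`, `κ ≤ |ω(y₀)|`, whose direction budget is at most `δ` times its
saturation. The SUP-sine form of this rung is the tree's `typeIAncientMild_uniform_window_decoherence`
(`ScaledTopAlignmentTypeIProfileUniformDecoherence`); this file proves the (profile-side stronger) BUDGET form by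
the same compactness-and-rigidity mechanism plus convergence of SECOND derivatives (the `C²_loc` tools of
`ScaledTopAlignmentTypeIProfileHessianTools`):

* **`typeIAncientMild_uniform_window_budget_decoherence`** — for every `C`, `κ > 0`, `λ₀ < 1`, `R₀ > 0`, `s < 0`
  there is `δ > 0` with `δ · ∫_S |ω|^{5/2} < ∫_S |ω|^{3/2} ‖∇ξ‖²` on every window `S` as above of every
  `W ∈ IsTypeIAncientMild C` (`ω = curl W(s)`). Proof: otherwise windows of profiles `W_n` around `y₀ⁿ` have
  budget `≤ saturation/(n+1)`; translate `y₀ⁿ ↦ 0`, extract a `C²_loc`-convergent subsequence; the limit has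
  `|ω_∞(0)| ≥ κ`, hence a ball `B` around `0` inside every late window on which the vorticity stays away from
  zero; the saturations of the late windows are bounded (locally uniform convergence on a fixed compact ball),
  so the budgets tend to zero, and FATOU (`lintegral_liminf_le'`; the budget densities converge pointwise on
  `B`) gives `∫_B |ω_∞|^{3/2} ‖∇ξ_∞‖² = 0`; by continuity `∇ξ_∞ ≡ 0` on `B`, so `ξ_∞` is constant on `B`
  (`IsOpen.is_const_of_fderiv_eq_zero`) — an ALIGNED WINDOW — and LocalSineTubeDoor's
  `eq_zero_of_aligned_window` forces `W_∞ ≡ 0`, contradicting `|ω_∞(0)| ≥ κ > 0`;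
* `typeIAncientMild_uniform_window_budget_decoherence_nearMax` — the same in the literal binder shape of the
  planner's `TypeIUniformDecoherence` (an extra, unused, slice bound `m⋆` with `λ₀ m⋆ ≤ |ω(y₀)|`; conclusion
  `budget ≤ δ · saturation → False`), so that the SPLIT-9 rung closes by name.

Consequence for the line: the profile-side content of every alignment door AND of the budget split is uniform
and quantitative on the Type-I(C) class — «a direction budget below `δ(C)` × saturation is impossible in ANY
rate-floor window of ANY Type-I(C) profile»; `δ` comes from compactness and is not explicit. WHAT THIS IS NOT:
not NS regularity and not a statement about Type-II blow-up; a theorem about the (possibly trivial) class of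
Type-I ancient mild profiles; the universal a-priori law UD/UDW of the split (content on regular flows) is
untouched. [folklore]
-/

noncomputable section

-- the summit and its single sub-problem share the name (CONVENTIONS §1), as in every Theorems file
set_option linter.dupNamespace false

open Set Function Filter Topology Metric MeasureTheory
open scoped RealInnerProductSpace ENNReal
open Literature.Analysis Literature.Analysis.FluidPDE
open Summit.NavierStokesRegularity.NavierStokesRegularity.Theorems.LocalSineTubeDoorProfileAlignedWindowRigidity

namespace Summit.NavierStokesRegularity.NavierStokesRegularity.Theorems

/-! ### Uniform budget-decoherence of Type-I profiles -/

/-- **Type-I blow-up profiles are uniformly budget-decoherent.** For every `C`, `κ > 0`, `λ₀ < 1`, `R₀ > 0`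
and `s < 0` there is `δ > 0` such that for every `W ∈ IsTypeIAncientMild C` and every `y₀` with
`κ ≤ |curl W(s)(y₀)|`, on the window `S = {y : λ₀|curl W(s)(y₀)| ≤ |curl W(s)(y)|, |y − y₀| ≤ R₀/√|curl W(s)(y₀)|}`
the `a = 3/2` direction budget beats `δ` times its saturation:
`δ · ∫_S |ω|^{5/2} < ∫_S |ω|^{3/2} ‖D(ω/|ω|)‖²`, `ω = curl W(s)`. `C²_loc` compactness of the class
(`exists_tendsto_hessian_of_isTypeIAncientMild_seq`), Fatou on a ball inside every late window, constancy of
a map with zero derivative on a ball, and the aligned-window rigidity `eq_zero_of_aligned_window` (module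
docstring). [cite: KochNadirashviliSereginSverak2009, Prop. 4.1 and Lemma 6.1 (arXiv:0709.3599 pp. 8, 11); GigaMiura2011, §2] -/
theorem typeIAncientMild_uniform_window_budget_decoherence {C κ lam0 R0 s : ℝ} (hκ : 0 < κ)
    (hlam1 : lam0 < 1) (hR0 : 0 < R0) (hs : s < 0) :
    ∃ δ : ℝ, 0 < δ ∧ ∀ (U : ℝ → EuclideanSpace ℝ (Fin 3) → EuclideanSpace ℝ (Fin 3)),
      IsTypeIAncientMild C U → ∀ y0 : EuclideanSpace ℝ (Fin 3), κ ≤ ‖curl (U s) y0‖ →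
        ENNReal.ofReal δ *
          (∫⁻ y in {y : EuclideanSpace ℝ (Fin 3) | lam0 * ‖curl (U s) y0‖ ≤ ‖curl (U s) y‖ ∧
              ‖y - y0‖ ≤ R0 / Real.sqrt ‖curl (U s) y0‖}, ENNReal.ofReal (‖curl (U s) y‖ ^ (5 / 2 : ℝ))) <
        ∫⁻ y in {y : EuclideanSpace ℝ (Fin 3) | lam0 * ‖curl (U s) y0‖ ≤ ‖curl (U s) y‖ ∧
              ‖y - y0‖ ≤ R0 / Real.sqrt ‖curl (U s) y0‖},
            ENNReal.ofReal (‖curl (U s) y‖ ^ (3 / 2 : ℝ) *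
              ‖fderiv ℝ (vorticityDirection (curl (U s))) y‖ ^ 2) := by
  by_contra hcon
  -- ## violators at every level `1/(n+1)`
  have hseq : ∀ n : ℕ, ∃ U : ℝ → EuclideanSpace ℝ (Fin 3) → EuclideanSpace ℝ (Fin 3),
      IsTypeIAncientMild C U ∧ ∃ y0 : EuclideanSpace ℝ (Fin 3), κ ≤ ‖curl (U s) y0‖ ∧
        (∫⁻ y in {y : EuclideanSpace ℝ (Fin 3) | lam0 * ‖curl (U s) y0‖ ≤ ‖curl (U s) y‖ ∧
              ‖y - y0‖ ≤ R0 / Real.sqrt ‖curl (U s) y0‖},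
            ENNReal.ofReal (‖curl (U s) y‖ ^ (3 / 2 : ℝ) *
              ‖fderiv ℝ (vorticityDirection (curl (U s))) y‖ ^ 2)) ≤
        ENNReal.ofReal (1 / ((n : ℝ) + 1)) *
          (∫⁻ y in {y : EuclideanSpace ℝ (Fin 3) | lam0 * ‖curl (U s) y0‖ ≤ ‖curl (U s) y‖ ∧
              ‖y - y0‖ ≤ R0 / Real.sqrt ‖curl (U s) y0‖}, ENNReal.ofReal (‖curl (U s) y‖ ^ (5 / 2 : ℝ))) := by
    intro n
    by_contra h
    push Not at h
    exact hcon ⟨1 / ((n : ℝ) + 1), by positivity, fun U hU y0 hy0 => h U hU y0 hy0⟩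
  choose U hU y0 hy0 hle using hseq
  -- ## abbreviations for the violating windows and densities
  set SU : ℕ → Set (EuclideanSpace ℝ (Fin 3)) := fun n =>
    {y : EuclideanSpace ℝ (Fin 3) | lam0 * ‖curl (U n s) (y0 n)‖ ≤ ‖curl (U n s) y‖ ∧
      ‖y - y0 n‖ ≤ R0 / Real.sqrt ‖curl (U n s) (y0 n)‖} with hSU
  set decU : ℕ → EuclideanSpace ℝ (Fin 3) → ℝ≥0∞ := fun n y =>
    ENNReal.ofReal (‖curl (U n s) y‖ ^ (3 / 2 : ℝ) *
      ‖fderiv ℝ (vorticityDirection (curl (U n s))) y‖ ^ 2) with hdecU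
  set satU : ℕ → EuclideanSpace ℝ (Fin 3) → ℝ≥0∞ := fun n y =>
    ENNReal.ofReal (‖curl (U n s) y‖ ^ (5 / 2 : ℝ)) with hsatU
  have hle' : ∀ n, ∫⁻ y in SU n, decU n y ≤ ENNReal.ofReal (1 / ((n : ℝ) + 1)) * ∫⁻ y in SU n, satU n y :=
    fun n => hle n
  -- ## translate the window centres to the origin
  set V : ℕ → ℝ → EuclideanSpace ℝ (Fin 3) → EuclideanSpace ℝ (Fin 3) := fun n t x => U n t (x + y0 n) with hV
  have hVcl : ∀ n, IsTypeIAncientMild C (V n) := fun n =>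
    translationInvariantAfter_isTypeIAncientMild_comp_add_right (hU n) (y0 n)
  have hcurlV : ∀ n y, curl (V n s) y = curl (U n s) (y + y0 n) := fun n y => by
    simp only [hV, curl, fderiv_comp_add_right]
  have hc0 : ∀ n, curl (U n s) (y0 n) = curl (V n s) 0 := fun n => by rw [hcurlV, zero_add]
  have hDdirV : ∀ n y, fderiv ℝ (vorticityDirection (curl (U n s))) (y + y0 n) =
      fderiv ℝ (vorticityDirection (curl (V n s))) y := fun n y => by
    rw [show vorticityDirection (curl (V n s)) = fun y => vorticityDirection (curl (U n s)) (y + y0 n) from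
      funext fun y => by simp only [vorticityDirection, hcurlV], fderiv_comp_add_right]
  -- smoothness of the slices and of their vorticities
  have hUc : ∀ n, Continuous (curl (U n s)) := fun n =>
    (contDiff_curl_slice_of_isTypeIAncientMild (hU n) hs).continuous
  have hVcd : ∀ n, Differentiable ℝ (curl (V n s)) := fun n =>
    (contDiff_curl_slice_of_isTypeIAncientMild (hVcl n) hs).differentiable (by simp)
  have hV2 : ∀ n, ContDiff ℝ 2 (V n s) := fun n => contDiff_infty.1 ((hVcl n).contDiff_slice hs) 2
  -- measurability of the windows and densities
  have hSU_meas : ∀ n, MeasurableSet (SU n) := fun n =>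
    (isClosed_le continuous_const (hUc n).norm).measurableSet.inter
      (isClosed_le (continuous_id.sub continuous_const).norm continuous_const).measurableSet
  have hdec_meas : ∀ n, Measurable (decU n) := fun n => measurable_budgetDensity (hUc n)
  -- ## compactness of the class, second derivatives included
  obtain ⟨φ, hφ, W, hW, -, hluD, hluH⟩ := exists_tendsto_hessian_of_isTypeIAncientMild_seq C hVcl
  have hφt : Tendsto φ atTop atTop := hφ.tendsto_atTop
  have hWcsm : ContDiff ℝ (⊤ : ℕ∞) (curl (W s)) := contDiff_curl_slice_of_isTypeIAncientMild hW hs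
  have hWc : Continuous (curl (W s)) := hWcsm.continuous
  have hWcd : Differentiable ℝ (curl (W s)) := hWcsm.differentiable (by simp)
  have hW2 : ContDiff ℝ 2 (W s) := contDiff_infty.1 (hW.contDiff_slice hs) 2
  -- vorticity convergence at time `s`: locally uniformly, pointwise, and pointwise for the derivatives
  have hluω : TendstoLocallyUniformly (fun j => curl (V (φ j) s)) (curl (W s)) atTop :=
    curlCLM.uniformContinuous.comp_tendstoLocallyUniformly (hluD s hs)
  have hω : ∀ y, Tendsto (fun j => curl (V (φ j) s) y) atTop (𝓝 (curl (W s) y)) := fun y =>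
    hluω.tendstoLocallyUniformlyOn.tendsto_at (mem_univ y)
  have hDω : ∀ y, Tendsto (fun j => fderiv ℝ (curl (V (φ j) s)) y) atTop
      (𝓝 (fderiv ℝ (curl (W s)) y)) := fun y =>
    tendsto_fderiv_curl (fun j => hV2 (φ j)) hW2 ((hluH s hs).tendstoLocallyUniformlyOn.tendsto_at (mem_univ y))
  -- the limit amplitude at the origin
  set a : EuclideanSpace ℝ (Fin 3) := curl (W s) 0 with ha
  have hκa : κ ≤ ‖a‖ := by
    refine ge_of_tendsto (hω 0).norm (Eventually.of_forall fun j => ?_)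
    rw [← hc0]
    exact hy0 (φ j)
  have hapos : 0 < ‖a‖ := hκ.trans_le hκa
  have ha0 : a ≠ 0 := norm_pos_iff.1 hapos
  -- the limit profile and its vorticity slice
  have hmildW : ∀ s' t : ℝ, s' < t → t < 0 → ∀ y : EuclideanSpace ℝ (Fin 3),
      W t y = UnboundedOperators.heatExtension (W s') (t - s') y - oseenDuhamel 1 s' W W t y :=
    fun s' t hst ht y => hW.mild_eq_heatExtension hst ht y
  -- ## a ball around the origin inside every late window
  set lam' : ℝ := max lam0 0 with hlam'
  have hlam'1 : lam' < 1 := max_lt hlam1 one_pos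
  have hlam'0 : 0 ≤ lam' := le_max_right _ _
  set m : ℝ := (1 - lam') / 2 * ‖a‖ with hm
  have hm0 : 0 < m := by
    have : 0 < 1 - lam' := by linarith
    positivity
  obtain ⟨r₁, hr₁, hr₁'⟩ : ∃ r₁ > 0, ∀ y : EuclideanSpace ℝ (Fin 3), ‖y‖ < r₁ → ‖curl (W s) y - a‖ < m := by
    obtain ⟨δ, hδ, h⟩ := Metric.continuousAt_iff.1 (hWc.continuousAt (x := 0)) m hm0
    refine ⟨δ, hδ, fun y hy => ?_⟩
    have := h (by rwa [dist_zero_right])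
    rwa [dist_eq_norm] at this
  set r : ℝ := min r₁ (R0 / Real.sqrt (2 * ‖a‖)) with hr
  have hr0 : 0 < r := lt_min hr₁ (by positivity)
  have hball : ∀ y : EuclideanSpace ℝ (Fin 3), ‖y‖ < r →
      curl (W s) y ≠ 0 ∧ lam0 * ‖a‖ + m < ‖curl (W s) y‖ := by
    intro y hy
    have hy1 : ‖y‖ < r₁ := lt_of_lt_of_le hy (min_le_left _ _)
    have hclose := hr₁' y hy1
    have hlow : ‖a‖ - m < ‖curl (W s) y‖ := by
      have := norm_sub_norm_le a (curl (W s) y)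
      rw [norm_sub_rev] at hclose
      linarith
    have h1 : lam0 * ‖a‖ ≤ lam' * ‖a‖ := mul_le_mul_of_nonneg_right (le_max_left _ _) hapos.le
    have h2 : lam' * ‖a‖ + m ≤ ‖a‖ - m := by rw [hm]; nlinarith
    have hpos : 0 < ‖curl (W s) y‖ := by
      have h3 : 0 ≤ lam' * ‖a‖ := mul_nonneg hlam'0 hapos.le
      linarith
    exact ⟨norm_pos_iff.1 hpos, by linarith⟩
  -- pointwise: every point of the ball lies in every late (translated) window
  have hmem : ∀ y : EuclideanSpace ℝ (Fin 3), ‖y‖ < r → ∀ᶠ j in atTop, y + y0 (φ j) ∈ SU (φ j) := by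
    intro y hy
    obtain ⟨hb0, hlev⟩ := hball y hy
    have hn0 : Tendsto (fun j => ‖curl (V (φ j) s) 0‖) atTop (𝓝 ‖a‖) := (hω 0).norm
    have hny : Tendsto (fun j => ‖curl (V (φ j) s) y‖) atTop (𝓝 ‖curl (W s) y‖) := (hω y).norm
    have e1 : ∀ᶠ j in atTop, ‖curl (V (φ j) s) 0‖ < 2 * ‖a‖ := hn0.eventually_lt_const (by linarith)
    have e2 : ∀ᶠ j in atTop, 0 < ‖curl (V (φ j) s) y‖ - lam0 * ‖curl (V (φ j) s) 0‖ :=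
      (hny.sub (hn0.const_mul lam0)).eventually_const_lt (by linarith)
    have e3 : ∀ᶠ j in atTop, ‖a‖ / 2 < ‖curl (V (φ j) s) 0‖ := hn0.eventually_const_lt (by linarith)
    filter_upwards [e1, e2, e3] with j h1 h2 h3
    have hcen : 0 < ‖curl (V (φ j) s) 0‖ := by linarith
    refine ⟨?_, ?_⟩
    · rw [hc0, ← hcurlV]
      linarith
    · rw [add_sub_cancel_right, hc0]
      have hy2 : ‖y‖ < R0 / Real.sqrt (2 * ‖a‖) := lt_of_lt_of_le hy (min_le_right _ _)
      have hmono : R0 / Real.sqrt (2 * ‖a‖) ≤ R0 / Real.sqrt ‖curl (V (φ j) s) 0‖ :=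
        div_le_div_of_nonneg_left hR0.le (Real.sqrt_pos.2 hcen) (Real.sqrt_le_sqrt h1.le)
      linarith
  -- ## a uniform bound for the late vorticities on a fixed compact ball, hence for the saturations
  set R : ℝ := R0 / Real.sqrt (‖a‖ / 2) with hR
  obtain ⟨M₀, hM₀⟩ := (isCompact_closedBall (0 : EuclideanSpace ℝ (Fin 3)) R).exists_bound_of_continuousOn
    hWc.continuousOn
  have hM₀0 : 0 ≤ M₀ := (norm_nonneg _).trans (hM₀ 0 (mem_closedBall_self (by positivity)))
  set M : ℝ := M₀ + 1 with hM
  have hMpos : 0 < M := by linarith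
  have hunif : ∀ᶠ j in atTop, ∀ y ∈ closedBall (0 : EuclideanSpace ℝ (Fin 3)) R,
      dist (curl (W s) y) (curl (V (φ j) s) y) < 1 :=
    Metric.tendstoUniformlyOn_iff.1
      ((tendstoLocallyUniformly_iff_forall_isCompact.1 hluω) _ (isCompact_closedBall 0 R)) 1 one_pos
  set Z : ℝ≥0∞ := ENNReal.ofReal (M ^ (5 / 2 : ℝ)) *
    volume (closedBall (0 : EuclideanSpace ℝ (Fin 3)) R) with hZ
  have hZtop : Z ≠ ⊤ := ENNReal.mul_ne_top ENNReal.ofReal_ne_top measure_closedBall_lt_top.ne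
  have hsat : ∀ᶠ j in atTop, ∫⁻ y in SU (φ j), satU (φ j) y ≤ Z := by
    have e3 : ∀ᶠ j in atTop, ‖a‖ / 2 < ‖curl (V (φ j) s) 0‖ :=
      (hω 0).norm.eventually_const_lt (by linarith)
    filter_upwards [hunif, e3] with j hj h3
    -- the window lies in the ball of radius `R` around its centre, where `|curl U| ≤ M`
    have hsub : SU (φ j) ⊆ closedBall (y0 (φ j)) R := fun y hy => by
      rw [mem_closedBall, dist_eq_norm]
      refine hy.2.trans ?_
      rw [hc0]
      exact div_le_div_of_nonneg_left hR0.le (Real.sqrt_pos.2 (by positivity)) (Real.sqrt_le_sqrt h3.le)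
    have hbd : ∀ y ∈ SU (φ j), satU (φ j) y ≤ ENNReal.ofReal (M ^ (5 / 2 : ℝ)) := fun y hy => by
      have hyR : y - y0 (φ j) ∈ closedBall (0 : EuclideanSpace ℝ (Fin 3)) R := by
        rw [mem_closedBall, dist_zero_right, ← dist_eq_norm]; exact hsub hy
      have hnorm : ‖curl (U (φ j) s) y‖ ≤ M := by
        have hd := hj _ hyR
        rw [dist_eq_norm, hcurlV, sub_add_cancel] at hd
        have := norm_le_norm_add_norm_sub (curl (W s) (y - y0 (φ j))) (curl (U (φ j) s) y)
        linarith [hM₀ _ hyR]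
      exact ENNReal.ofReal_le_ofReal (Real.rpow_le_rpow (norm_nonneg _) hnorm (by norm_num))
    calc ∫⁻ y in SU (φ j), satU (φ j) y
        ≤ ∫⁻ y in SU (φ j), ENNReal.ofReal (M ^ (5 / 2 : ℝ)) := setLIntegral_mono measurable_const hbd
      _ = ENNReal.ofReal (M ^ (5 / 2 : ℝ)) * volume (SU (φ j)) := setLIntegral_const _ _
      _ ≤ ENNReal.ofReal (M ^ (5 / 2 : ℝ)) * volume (closedBall (y0 (φ j)) R) :=
          mul_le_mul_right (measure_mono hsub) _
      _ = Z := by rw [hZ, Measure.addHaar_closedBall_center]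
  -- ## Fatou on the ball `B(0,r)` for the translated budget densities
  set G : ℕ → EuclideanSpace ℝ (Fin 3) → ℝ≥0∞ := fun j y =>
    (SU (φ j)).indicator (decU (φ j)) (y + y0 (φ j)) with hG
  have hG_meas : ∀ j, Measurable (G j) := fun j =>
    ((hdec_meas _).indicator (hSU_meas _)).comp (measurable_add_const _)
  have hGint : ∀ j, ∫⁻ y, G j y = ∫⁻ y in SU (φ j), decU (φ j) y := fun j => by
    simp only [hG]
    rw [lintegral_add_right_eq_self (μ := (volume : Measure (EuclideanSpace ℝ (Fin 3))))
      (fun y => (SU (φ j)).indicator (decU (φ j)) y) (y0 (φ j)), lintegral_indicator (hSU_meas _)]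
  -- the budget integrals of the late windows tend to zero
  set b : ℕ → ℝ≥0∞ := fun j => ENNReal.ofReal (1 / ((φ j : ℝ) + 1)) * Z with hb
  have hb0 : Tendsto b atTop (𝓝 0) := by
    have h1 : Tendsto (fun j => ENNReal.ofReal (1 / ((φ j : ℝ) + 1))) atTop (𝓝 0) := by
      rw [← ENNReal.ofReal_zero]
      exact ENNReal.tendsto_ofReal (tendsto_one_div_add_atTop_nhds_zero_nat.comp hφt)
    have h2 := ENNReal.Tendsto.mul_const h1 (Or.inr hZtop)
    rwa [zero_mul] at h2
  have hGle : ∀ᶠ j in atTop, ∫⁻ y in ball (0 : EuclideanSpace ℝ (Fin 3)) r, G j y ≤ b j := by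
    filter_upwards [hsat] with j hj
    calc ∫⁻ y in ball (0 : EuclideanSpace ℝ (Fin 3)) r, G j y ≤ ∫⁻ y, G j y := setLIntegral_le_lintegral _ _
      _ = ∫⁻ y in SU (φ j), decU (φ j) y := hGint j
      _ ≤ ENNReal.ofReal (1 / ((φ j : ℝ) + 1)) * ∫⁻ y in SU (φ j), satU (φ j) y := hle' (φ j)
      _ ≤ b j := mul_le_mul_right hj _
  -- pointwise limit of the translated densities on the ball
  set decW : EuclideanSpace ℝ (Fin 3) → ℝ≥0∞ := fun y =>
    ENNReal.ofReal (‖curl (W s) y‖ ^ (3 / 2 : ℝ) * ‖fderiv ℝ (vorticityDirection (curl (W s))) y‖ ^ 2)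
    with hdecW
  have hGlim : ∀ y ∈ ball (0 : EuclideanSpace ℝ (Fin 3)) r, Tendsto (fun j => G j y) atTop (𝓝 (decW y)) := by
    intro y hy
    rw [mem_ball, dist_zero_right] at hy
    obtain ⟨hb0', -⟩ := hball y hy
    have hDξ : Tendsto (fun j => fderiv ℝ (vorticityDirection (curl (V (φ j) s))) y) atTop
        (𝓝 (fderiv ℝ (vorticityDirection (curl (W s))) y)) :=
      tendsto_fderiv_vorticityDirection (fun j => (hVcd (φ j)) y) (hWcd y) hb0' (hω y) (hDω y)
    have hlimV : Tendsto (fun j => ENNReal.ofReal (‖curl (V (φ j) s) y‖ ^ (3 / 2 : ℝ) *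
        ‖fderiv ℝ (vorticityDirection (curl (V (φ j) s))) y‖ ^ 2)) atTop (𝓝 (decW y)) :=
      ENNReal.tendsto_ofReal ((((hω y).norm).rpow_const (Or.inr (by norm_num))).mul
        ((hDξ.norm).pow 2))
    refine hlimV.congr' ?_
    filter_upwards [hmem y hy] with j hj
    simp only [hG]
    rw [indicator_of_mem hj, hdecU]
    simp only []
    rw [← hcurlV, hDdirV]
  have hFatou : ∫⁻ y in ball (0 : EuclideanSpace ℝ (Fin 3)) r, decW y = 0 := by
    refine le_antisymm ?_ bot_le
    calc ∫⁻ y in ball (0 : EuclideanSpace ℝ (Fin 3)) r, decW y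
        = ∫⁻ y in ball (0 : EuclideanSpace ℝ (Fin 3)) r, liminf (fun j => G j y) atTop :=
          setLIntegral_congr_fun measurableSet_ball (fun y hy => ((hGlim y hy).liminf_eq).symm)
      _ ≤ liminf (fun j => ∫⁻ y in ball (0 : EuclideanSpace ℝ (Fin 3)) r, G j y) atTop :=
          lintegral_liminf_le' fun j => (hG_meas j).aemeasurable
      _ ≤ liminf b atTop := liminf_le_liminf hGle
      _ = 0 := hb0.liminf_eq
  -- ## the limit direction field has zero derivative on the ball, hence is constant there
  set g : EuclideanSpace ℝ (Fin 3) → ℝ := fun y =>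
    ‖curl (W s) y‖ ^ (3 / 2 : ℝ) * ‖fderiv ℝ (vorticityDirection (curl (W s))) y‖ ^ 2 with hg
  have hξC1 : ∀ y ∈ ball (0 : EuclideanSpace ℝ (Fin 3)) r,
      ContDiffAt ℝ 1 (vorticityDirection (curl (W s))) y := by
    intro y hy
    rw [mem_ball, dist_zero_right] at hy
    exact contDiffAt_vorticityDirection ((hWcsm.of_le (by exact_mod_cast le_top)).contDiffAt)
      (hball y hy).1
  have hgc : ContinuousOn g (ball (0 : EuclideanSpace ℝ (Fin 3)) r) := by
    have h1 : ContinuousOn (fun y => ‖curl (W s) y‖ ^ (3 / 2 : ℝ)) (ball (0 : EuclideanSpace ℝ (Fin 3)) r) :=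
      hWc.norm.continuousOn.rpow_const fun _ _ => Or.inr (by norm_num)
    have h2 : ContinuousOn (fun y => ‖fderiv ℝ (vorticityDirection (curl (W s))) y‖ ^ 2)
        (ball (0 : EuclideanSpace ℝ (Fin 3)) r) := by
      refine ContinuousOn.pow (ContinuousOn.norm fun y hy => ?_) 2
      exact (((hξC1 y hy).fderiv_right (m := 0) (by norm_num)).continuousAt).continuousWithinAt
    exact h1.mul h2
  have hg0 : ∀ y ∈ ball (0 : EuclideanSpace ℝ (Fin 3)) r, g y = 0 := by
    have hae : ∀ᵐ y ∂(volume : Measure (EuclideanSpace ℝ (Fin 3))),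
        y ∈ ball (0 : EuclideanSpace ℝ (Fin 3)) r → decW y = 0 :=
      (setLIntegral_eq_zero_iff' measurableSet_ball (measurable_budgetDensity hWc).aemeasurable).1 hFatou
    have hae' : g =ᵐ[volume.restrict (ball (0 : EuclideanSpace ℝ (Fin 3)) r)] fun _ => (0 : ℝ) := by
      rw [EventuallyEq, ae_restrict_iff' measurableSet_ball]
      filter_upwards [hae] with y hy hyb
      have h0 := hy hyb
      simp only [hdecW, ENNReal.ofReal_eq_zero] at h0
      have hnn : 0 ≤ g y := by simp only [hg]; positivity
      exact le_antisymm h0 hnn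
    exact Measure.eqOn_open_of_ae_eq hae' isOpen_ball hgc continuousOn_const
  have hD0 : ∀ y ∈ ball (0 : EuclideanSpace ℝ (Fin 3)) r, fderiv ℝ (vorticityDirection (curl (W s))) y = 0 := by
    intro y hy
    have hy' : ‖y‖ < r := by rwa [mem_ball, dist_zero_right] at hy
    have hpos : 0 < ‖curl (W s) y‖ := norm_pos_iff.2 (hball y hy').1
    have h := hg0 y hy
    simp only [hg] at h
    have hp : 0 < ‖curl (W s) y‖ ^ (3 / 2 : ℝ) := Real.rpow_pos_of_pos hpos _
    have hsq : ‖fderiv ℝ (vorticityDirection (curl (W s))) y‖ ^ 2 = 0 := by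
      rcases mul_eq_zero.1 h with h | h
      · exact absurd h hp.ne'
      · exact h
    exact norm_eq_zero.1 (pow_eq_zero_iff two_ne_zero |>.1 hsq)
  have hconst : ∀ y ∈ ball (0 : EuclideanSpace ℝ (Fin 3)) r,
      vorticityDirection (curl (W s)) y = vorticityDirection (curl (W s)) 0 := fun y hy =>
    isOpen_ball.is_const_of_fderiv_eq_zero (convex_ball (0 : EuclideanSpace ℝ (Fin 3)) r).isPreconnected
      (fun z hz => (((hξC1 z hz).differentiableAt one_ne_zero)).differentiableWithinAt)
      (fun z hz => hD0 z hz) hy (mem_ball_self hr0)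
  -- ## an aligned window: the vorticity is parallel to `e = ξ(0)` on the ball
  set e : EuclideanSpace ℝ (Fin 3) := vorticityDirection (curl (W s)) 0 with he
  have he1 : ‖e‖ = 1 := norm_vorticityDirection _ ha0
  have he0 : e ≠ 0 := by
    intro h0; rw [h0, norm_zero] at he1; exact zero_ne_one he1
  have hal : ∀ y ∈ ball (0 : EuclideanSpace ℝ (Fin 3)) r, cross (curl (W s) y) e = 0 := by
    intro y hy
    have hy' : ‖y‖ < r := by rwa [mem_ball, dist_zero_right] at hy
    have hb0' := (hball y hy').1
    refine cross_eq_zero_of_dirSine_eq_zero he0 hb0' ?_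
    have hξ : ‖curl (W s) y‖⁻¹ • curl (W s) y = e := hconst y hy
    rw [hξ, he1, inv_one, one_smul, real_inner_self_eq_norm_sq, he1]
    norm_num
  -- ## the aligned-window rigidity forces the limit profile to vanish
  have hWzero : ∀ t < 0, ∀ y, W t y = 0 :=
    eq_zero_of_aligned_window hW.hasTypeITimeDecay hW.continuousOn_uncurry hmildW
      (fun t ht => hW.isDivFree ht) hs he0 isOpen_ball ⟨0, mem_ball_self hr0⟩ hal
  have hWs : W s = fun _ => (0 : EuclideanSpace ℝ (Fin 3)) := funext fun y => hWzero s hs y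
  have ha' : a = 0 := by
    rw [ha]
    apply curl_eq_zero_of_fderiv_eq_zero
    rw [hWs]
    simp
  exact ha0 ha'

/-- **Q(C) in the planner's binder shape.** For every `C`, `κ > 0`, `λ₀ < 1`, `R₀ > 0` and `s < 0` there is
`δ > 0` such that for every `W ∈ IsTypeIAncientMild C`, every slice bound `m⋆ > 0` of `|curl W(s)|`, every `y₀`
with `κ ≤ |curl W(s)(y₀)|` and `λ₀ m⋆ ≤ |curl W(s)(y₀)|`, a window direction budget of at most `δ` times the
window saturation is absurd — the body of SPLIT-9's `TypeIUniformDecoherence κ λ₀ R₀` at `s = -1` with the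
direction field spelled `vorticityDirection`. The near-maximality hypothesis is not used. [folklore] -/
theorem typeIAncientMild_uniform_window_budget_decoherence_nearMax {C κ lam0 R0 s : ℝ} (hκ : 0 < κ)
    (hlam1 : lam0 < 1) (hR0 : 0 < R0) (hs : s < 0) :
    ∃ δ : ℝ, 0 < δ ∧ ∀ (U : ℝ → EuclideanSpace ℝ (Fin 3) → EuclideanSpace ℝ (Fin 3)),
      IsTypeIAncientMild C U → ∀ mstar : ℝ, 0 < mstar → (∀ x, ‖curl (U s) x‖ ≤ mstar) →
      ∀ y0 : EuclideanSpace ℝ (Fin 3), κ ≤ ‖curl (U s) y0‖ → lam0 * mstar ≤ ‖curl (U s) y0‖ →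
        (∫⁻ y in {y : EuclideanSpace ℝ (Fin 3) | lam0 * ‖curl (U s) y0‖ ≤ ‖curl (U s) y‖ ∧
              ‖y - y0‖ ≤ R0 / Real.sqrt ‖curl (U s) y0‖},
            ENNReal.ofReal (‖curl (U s) y‖ ^ (3 / 2 : ℝ) *
              ‖fderiv ℝ (vorticityDirection (curl (U s))) y‖ ^ 2)) ≤
        ENNReal.ofReal δ *
          (∫⁻ y in {y : EuclideanSpace ℝ (Fin 3) | lam0 * ‖curl (U s) y0‖ ≤ ‖curl (U s) y‖ ∧
              ‖y - y0‖ ≤ R0 / Real.sqrt ‖curl (U s) y0‖}, ENNReal.ofReal (‖curl (U s) y‖ ^ (5 / 2 : ℝ))) →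
        False := by
  obtain ⟨δ, hδ, h⟩ := typeIAncientMild_uniform_window_budget_decoherence (C := C) hκ hlam1 hR0 hs
  exact ⟨δ, hδ, fun U hU _ _ _ y0 hy0 _ hle => absurd hle (not_le.2 (h U hU y0 hy0))⟩

end Summit.NavierStokesRegularity.NavierStokesRegularity.Theorems

end
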